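import Mathlib
import HarnessLib
import Summits.ResolutionOfSingularities.ResolutionOfSingularities.Theorems.WildQuotientsWildQuotientResolutionS1aRecoordStep

/-!
# S1a — THE UNIT RECOORDINATION STEP: `k[T_ι][1/h] ≃ k[T_ι][1/h′]` along `T_{l₀} ↦ u·T_{l₀} + q` with `u` a unit of both localisations (for centres that
# become variables only after a shear with a UNIT leading coefficient, e.g. MT-D₄'s move 3 along `x₂ = Z·s₂ + s·X₁` on the `[z′]` chart, `Z`, `X₁` units)

[OURS · L1 W4.5c · lead-1 g13; plan-1 R-F15e (I-3 move-by-move), NOTES `D4 TREE OF RECORD` (unit shear before move 3), FRAME-STATUS rev16 §3] — NOT statements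
of the manuscript; counted 0; AI-level work, weaker than expert review. Crux stmt-ResolutionOfSingularities-17941 `CyclicQuotientFourfolds`, line
`s1a-logminvertex` v13 (`stub_reachLowerInFX`). Pure commutative algebra, existence with pins (no definitions).

With `φ : T_{l₀} ↦ u·T_{l₀} + q` (`T_l ↦ T_l` otherwise; `u`, `q` free of `T_{l₀}`), `u ∣ h`, `u ∣ h′` and `φ(h′) = uⁿ·h`:
* ★ `exists_unitShearAwayEquiv` — `Ξ : k[T][1/h] ≃+* k[T][1/h′]` with `Ξ⁻¹(b) = φ(b)` for polynomials `b`, `Ξ(b) = b` for `b` free of `T_{l₀}`,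
  `u·Ξ(T_{l₀}) + q = T_{l₀}` (so the OLD coordinate `T_{l₀}` becomes the element `t = (T_{l₀} − q)/u` of the new model and the element `u·T_{l₀} + q` of the
  old model becomes the VARIABLE `T_{l₀}`), and `Ξ⁻¹(1/h′)·(uⁿh) = 1`.
Both directions are `IsLocalization.Away.lift`s (`φ` forward; `T_{l₀} ↦ (T_{l₀} − q)·u⁻¹` backward), inverse to each other by `IsLocalization.ringHom_ext`.
-/

set_option linter.dupNamespace false

noncomputable section

open MvPolynomial

namespace Summit.ResolutionOfSingularities.ResolutionOfSingularities.Theorems.WildQuotientResolution.S1.FreeModel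

variable (k : Type) [CommRing k] {ι : Type} [DecidableEq ι]

/-- In `A[1/h]`, a divisor of `h` is a unit. [folklore] -/
theorem isUnit_algebraMap_away_of_dvd {A : Type} [CommRing A] {u h : A} (hu : u ∣ h) :
    IsUnit (algebraMap A (Localization.Away h) u) := by
  obtain ⟨c, hc⟩ := hu
  refine IsUnit.of_mul_eq_one (algebraMap A (Localization.Away h) c * IsLocalization.Away.invSelf h) ?_
  rw [← mul_assoc, ← map_mul, ← hc, IsLocalization.Away.mul_invSelf]

/-- ★ **THE UNIT RECOORDINATION STEP.** For `φ : T_{l₀} ↦ u·T_{l₀} + q` (`u`, `q` free of `T_{l₀}`), `u ∣ h`, `u ∣ h′`, `φ h′ = uⁿ·h`: an isomorphism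
`Ξ : k[T_ι][1/h] ≃+* k[T_ι][1/h′]` with the pins `Ξ⁻¹ b = φ b`, `Ξ b = b` (`b` free of `T_{l₀}`), `u·Ξ(T_{l₀}) + q = T_{l₀}`, `Ξ⁻¹(h′⁻¹)·(uⁿh) = 1`.
[OURS · L1 W4.5c · (F-T8) models; NOT a statement of the manuscript] -/
theorem exists_unitShearAwayEquiv (l₀ : ι) (u q hh hh' : MvPolynomial ι k) (n : ℕ) (hu : l₀ ∉ u.vars) (hq : l₀ ∉ q.vars)
    (huh : u ∣ hh) (huh' : u ∣ hh')
    (H : MvPolynomial.aeval (fun l => if l = l₀ then u * X l₀ + q else X l) hh' = u ^ n * hh) :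
    ∃ Ξ : Localization.Away hh ≃+* Localization.Away hh',
      (∀ b : MvPolynomial ι k, Ξ.symm (algebraMap (MvPolynomial ι k) (Localization.Away hh') b) =
        algebraMap (MvPolynomial ι k) (Localization.Away hh) (MvPolynomial.aeval (fun l => if l = l₀ then u * X l₀ + q else X l) b)) ∧
      (∀ b : MvPolynomial ι k, l₀ ∉ b.vars →
        Ξ (algebraMap (MvPolynomial ι k) (Localization.Away hh) b) = algebraMap (MvPolynomial ι k) (Localization.Away hh') b) ∧
      algebraMap (MvPolynomial ι k) (Localization.Away hh') u * Ξ (algebraMap (MvPolynomial ι k) (Localization.Away hh) (X l₀)) +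
          algebraMap (MvPolynomial ι k) (Localization.Away hh') q = algebraMap (MvPolynomial ι k) (Localization.Away hh') (X l₀) ∧
      Ξ.symm (IsLocalization.Away.invSelf hh') * algebraMap (MvPolynomial ι k) (Localization.Away hh) (u ^ n * hh) = 1 := by
  -- notation
  set L := Localization.Away hh
  set L' := Localization.Away hh'
  set φ : MvPolynomial ι k →ₐ[k] MvPolynomial ι k := MvPolynomial.aeval (fun l => if l = l₀ then u * X l₀ + q else X l) with hφdef
  have hφ0 : φ (X l₀) = u * X l₀ + q := by rw [hφdef, aeval_X, if_pos rfl]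
  have hφ : ∀ l, l ≠ l₀ → φ (X l) = X l := fun l h => by rw [hφdef, aeval_X, if_neg h]
  -- polynomials free of `T_{l₀}` are fixed by `φ`
  have hφfix : ∀ b : MvPolynomial ι k, l₀ ∉ b.vars → φ b = b := by
    intro b hb
    have h := hom_congr_vars (f₁ := (φ : MvPolynomial ι k →+* MvPolynomial ι k)) (f₂ := RingHom.id _) (p₁ := b) (p₂ := b)
      (by ext a; simp) (fun i hi _ => by
        have hi' : i ≠ l₀ := fun h => hb (h ▸ hi)
        rw [RingHom.coe_coe, hφ i hi', RingHom.id_apply]) rfl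
    simpa using h
  -- the units
  have huL : IsUnit (algebraMap (MvPolynomial ι k) L u) := isUnit_algebraMap_away_of_dvd huh
  obtain ⟨c', hc'⟩ := huh'
  set ui : L' := algebraMap (MvPolynomial ι k) L' c' * IsLocalization.Away.invSelf hh' with hui_def
  have hui : algebraMap (MvPolynomial ι k) L' u * ui = 1 := by
    rw [hui_def, ← mul_assoc, ← map_mul, ← hc', IsLocalization.Away.mul_invSelf]
  -- forward: `Θ : L' → L` over `φ`
  have hΘu : IsUnit ((algebraMap (MvPolynomial ι k) L).comp (φ : MvPolynomial ι k →+* MvPolynomial ι k) hh') := by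
    rw [RingHom.comp_apply, RingHom.coe_coe, H, map_mul, map_pow]
    exact (huL.pow n).mul (IsLocalization.Away.algebraMap_isUnit hh)
  set Θ : L' →+* L := IsLocalization.Away.lift hh' hΘu with hΘdef
  have hΘ : ∀ b, Θ (algebraMap (MvPolynomial ι k) L' b) = algebraMap (MvPolynomial ι k) L (φ b) := fun b => by
    rw [hΘdef, IsLocalization.Away.lift_eq]; rfl
  -- backward: `ψ : k[T] → L'`, `T_{l₀} ↦ (T_{l₀} − q)·u⁻¹`
  set ψ : MvPolynomial ι k →ₐ[k] L' :=
    MvPolynomial.aeval (fun l => if l = l₀ then (algebraMap (MvPolynomial ι k) L' (X l₀) - algebraMap (MvPolynomial ι k) L' q) * ui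
      else algebraMap (MvPolynomial ι k) L' (X l)) with hψdef
  have hψ0 : ψ (X l₀) = (algebraMap (MvPolynomial ι k) L' (X l₀) - algebraMap (MvPolynomial ι k) L' q) * ui := by rw [hψdef, aeval_X, if_pos rfl]
  have hψ : ∀ l, l ≠ l₀ → ψ (X l) = algebraMap (MvPolynomial ι k) L' (X l) := fun l h => by rw [hψdef, aeval_X, if_neg h]
  have hψC : ∀ a : k, ψ (C a) = algebraMap (MvPolynomial ι k) L' (C a) := fun a => by
    rw [hψdef, aeval_C, IsScalarTower.algebraMap_apply k (MvPolynomial ι k) L' a, MvPolynomial.algebraMap_eq]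
  have hψfix : ∀ b : MvPolynomial ι k, l₀ ∉ b.vars → ψ b = algebraMap (MvPolynomial ι k) L' b := by
    intro b hb
    exact hom_congr_vars (f₁ := (ψ : MvPolynomial ι k →+* L')) (f₂ := algebraMap (MvPolynomial ι k) L') (p₁ := b) (p₂ := b)
      (by ext a; rw [RingHom.comp_apply, RingHom.comp_apply, RingHom.coe_coe, hψC]) (fun i hi _ => by
        have hi' : i ≠ l₀ := fun h => hb (h ▸ hi)
        rw [RingHom.coe_coe, hψ i hi']) rfl
  -- `ψ ∘ φ = algebraMap`
  have hψφ : ∀ b, ψ (φ b) = algebraMap (MvPolynomial ι k) L' b := by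
    intro b
    have h : ((ψ : MvPolynomial ι k →+* L').comp (φ : MvPolynomial ι k →+* MvPolynomial ι k)) = algebraMap (MvPolynomial ι k) L' := by
      refine MvPolynomial.ringHom_ext (fun a => ?_) (fun l => ?_)
      · rw [RingHom.comp_apply, RingHom.coe_coe, RingHom.coe_coe, show φ (C a) = C a from φ.commutes a, hψC]
      · rw [RingHom.comp_apply, RingHom.coe_coe, RingHom.coe_coe]
        by_cases hl : l = l₀
        · subst hl
          rw [hφ0, map_add, map_mul, hψ0, hψfix u hu, hψfix q hq]
          linear_combination (algebraMap (MvPolynomial ι k) L' (X l) - algebraMap (MvPolynomial ι k) L' q) * hui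
        · rw [hφ l hl, hψ l hl]
    exact RingHom.congr_fun h b
  have hψu : IsUnit ((ψ : MvPolynomial ι k →+* L') hh) := by
    have h1 : ψ (φ hh') = algebraMap (MvPolynomial ι k) L' hh' := hψφ hh'
    rw [H, map_mul, map_pow, hψfix u hu] at h1
    have h2 : IsUnit (algebraMap (MvPolynomial ι k) L' u ^ n * ψ hh) := by rw [h1]; exact IsLocalization.Away.algebraMap_isUnit hh'
    exact isUnit_of_mul_isUnit_right h2
  set Ψ : L →+* L' := IsLocalization.Away.lift hh hψu with hΨdef
  have hΨ : ∀ b, Ψ (algebraMap (MvPolynomial ι k) L b) = ψ b := fun b => by rw [hΨdef, IsLocalization.Away.lift_eq]; rfl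
  -- the two composites
  have hΘψ : ∀ b, Θ (ψ b) = algebraMap (MvPolynomial ι k) L b := by
    intro b
    have h : (Θ.comp (ψ : MvPolynomial ι k →+* L')) = algebraMap (MvPolynomial ι k) L := by
      refine MvPolynomial.ringHom_ext (fun a => ?_) (fun l => ?_)
      · rw [RingHom.comp_apply, RingHom.coe_coe, hψC, hΘ, show φ (C a) = C a from φ.commutes a]
      · rw [RingHom.comp_apply, RingHom.coe_coe]
        by_cases hl : l = l₀
        · subst hl
          have hΘui : algebraMap (MvPolynomial ι k) L u * Θ ui = 1 := by
            rw [← hφfix u hu, ← hΘ, ← map_mul, hui, map_one]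
          rw [hψ0, map_mul, map_sub, hΘ, hΘ, hφ0, hφfix q hq, map_add, map_mul]
          linear_combination (algebraMap (MvPolynomial ι k) L (X l)) * hΘui
        · rw [hψ l hl, hΘ, hφ l hl]
    exact RingHom.congr_fun h b
  have h₁ : Θ.comp Ψ = RingHom.id L := by
    refine IsLocalization.ringHom_ext (Submonoid.powers hh) (RingHom.ext fun b => ?_)
    rw [RingHom.comp_apply, RingHom.comp_apply, hΨ, hΘψ, RingHom.comp_apply, RingHom.id_apply]
  have h₂ : Ψ.comp Θ = RingHom.id L' := by
    refine IsLocalization.ringHom_ext (Submonoid.powers hh') (RingHom.ext fun b => ?_)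
    rw [RingHom.comp_apply, RingHom.comp_apply, hΘ, hΨ, hψφ, RingHom.comp_apply, RingHom.id_apply]
  refine ⟨RingEquiv.ofRingHom Ψ Θ h₂ h₁, fun b => hΘ b, fun b hb => ?_, ?_, ?_⟩
  · change Ψ _ = _
    rw [hΨ, hψfix b hb]
  · change _ * Ψ _ + _ = _
    rw [hΨ, hψ0]
    linear_combination (algebraMap (MvPolynomial ι k) L' (X l₀) - algebraMap (MvPolynomial ι k) L' q) * hui
  · change Θ _ * _ = _
    rw [← H, ← hΘ, ← map_mul, mul_comm, IsLocalization.Away.mul_invSelf, map_one]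

end Summit.ResolutionOfSingularities.ResolutionOfSingularities.Theorems.WildQuotientResolution.S1.FreeModel

end
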